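import Literature.Barriers.CriticalPhenomena.PlaquetteWalkHoleRootExtensionClasses
import Literature.Barriers.CriticalPhenomena.PlaquetteWalkColumnRuns
import HarnessLib

/-!
# Barrier catalogue (SAWScalingLimit): the ROOT-ROW LAW of the level-`5` limit model, reduced to the absence of doubly visited plaquettes
(«ROW LAW»)

`Z → ∞` limit model of the printed Yang–Baxter weights [GlazmanManolescu2019, §1, eq. (1)]; the «RECTANGLE COEFFICIENT» line. The ROW-COHERENCE
CRITERION `vertexFunctional_printed_zero_set_finite_of_rowCoherent` (#828) turns «every wound group member of limit cost `5` at `f₀` is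
row-coherent, and one of them ends on a slanted side» into «the printed vertex functional `VF_D(w.side W, f₀; ·)` is not identically zero».
`PlaquetteWalkHoleRootRowClasses` / `PlaquetteWalkHoleRootExtensionClasses` prove row-coherence of every member whose class-`B2a` walk has a
STRAIGHT PREFIX and an INJECTIVE plaquette map. Here, on the ROOT ROW `f₀ = (w.1 + k, w.2)`:

* private successor bookkeeping `YBWalk.sIn_succ_of_sOut_N/S`, public ★ `YBWalk.fc_add_of_straight_after_N/S`;
* ★★ `ΩG.prefix_straight_of_few_turns`: a class-`B2a` walk from the hole root at a root-row rhombus whose prefix carries at most ONE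
  turning arc has a straight prefix (one turn on the hole row sends the walk vertically off the row, and straight arcs keep it off);
* ★★★ `ΩG.prefix_straight_of_injective_cost_five` / `ΩG.prefix_straight_of_injective_cost_seven_east`: hence a WOUND class-`B2a` walk of
  limit cost `5` (resp. of cost `7` returning to `E` with a turning first arc) with injective plaquette map at a root-row rhombus HAS a straight
  prefix — its excursion alone carries `≥ 4` of its `5` (resp. `6`, one being the first arc in `r`) turning arcs
  (`PlaquetteWalkWoundExcursionTurning.four_le_excursion_turns_of_wound`);
* ★★★ `ΩG.rowCoherent_of_injective` — THE ROW LAW MODULO (R2): at a root-row rhombus every wound group member of limit cost `5` whose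
  class-`B2a` walk has an injective plaquette map is ROW-COHERENT;
* ★★★★ `PlaquetteWalk.vertexFunctional_printed_zero_set_finite_of_noDoubleVisit`: at a `W`-normalised hole root and a root-row rhombus
  `f₀`, IF no wound class-`B2a` walk at `f₀` of limit cost `5`, and no wound class-`B2a` walk at `f₀` of cost `7` returning to a vertical side
  with a turning first arc, visits a plaquette twice («(R2)», exact census kits j276221/j280313: `n_{w₁} = n_{w₂} = 0` in all of them), and
  some wound class-`B2a` walk of cost `5` exists at `f₀`, THEN `VF_D(w.side W, f₀; ·)` has finitely many zeros in `(0, π)`.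

Use (venture lane «pcv-sawmu», b-engine-1 g25): the lane's census law «Λ₅ ≠ 0 at every root-row cell with a cost-5 wound member» is hereby
reduced to the single structural statement (R2). [GlazmanManolescu2019 §1 Fig. 1, eq. (1), Lemma 2.1; Glazman 2015 Lemma 3.1 (proof, pp. 6–7)]
-/

noncomputable section

namespace Literature.Probability.RandomPlanarGeometry.SAW.YangBaxter

open Real
open Literature.Barriers.CriticalPhenomena.PlaquetteWalk

open private IsNS fc_fh from Literature.Probability.RandomPlanarGeometry.YangBaxterSAWGeneralDomain

namespace YBWalk

variable {D : Set Face} {a z : MidEdge} (γ : YBWalk D a z)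

/-- An arc leaving through `N` is followed by an arc entering through `S`. [cite: GlazmanManolescu2019, §1, Fig. 1 (consecutive arcs lie in adjacent rhombi)] -/
private theorem sIn_succ_of_sOut_N {i : ℕ} (hi : i + 1 < γ.arcs.length) (hN : γ.sOut i = .N) : γ.sIn (i + 1) = .S := by
  obtain ⟨-, hout⟩ := γ.side_sIn_eq_nth (show i < γ.arcs.length by omega)
  obtain ⟨hin, -⟩ := γ.side_sIn_eq_nth hi
  rw [hN] at hout
  have e : (γ.fc (i + 1)).side (γ.sIn (i + 1)) = .slant (γ.fc i).1 ((γ.fc i).2 + 1) := by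
    rw [hin, ← hout]; obtain ⟨k, j⟩ := γ.fc i; rfl
  rcases eq_of_side_eq_slant e with ⟨-, hs⟩ | ⟨h1, -⟩
  · exact hs
  · exfalso; refine γ.fc_succ_ne hi ?_
    rw [h1]; obtain ⟨k, j⟩ := γ.fc i; simp

/-- An arc leaving through `S` is followed by an arc entering through `N`. [cite: GlazmanManolescu2019, §1, Fig. 1] -/
private theorem sIn_succ_of_sOut_S {i : ℕ} (hi : i + 1 < γ.arcs.length) (hS : γ.sOut i = .S) : γ.sIn (i + 1) = .N := by
  obtain ⟨-, hout⟩ := γ.side_sIn_eq_nth (show i < γ.arcs.length by omega)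
  obtain ⟨hin, -⟩ := γ.side_sIn_eq_nth hi
  rw [hS] at hout
  have e : (γ.fc (i + 1)).side (γ.sIn (i + 1)) = .slant (γ.fc i).1 (γ.fc i).2 := by
    rw [hin, ← hout]; obtain ⟨k, j⟩ := γ.fc i; rfl
  rcases eq_of_side_eq_slant e with ⟨h1, -⟩ | ⟨-, hs⟩
  · exact absurd (h1.trans Prod.mk.eta).symm (γ.fc_succ_ne hi)
  · exact hs

/-- ★ **A STRAIGHT VERTICAL RUN**: if the arc `j` leaves through `N` and the arcs `j+1, …, j+n−1` are straight, then the arc `j + n` lies `n`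
rows above the arc `j`, in the same column (and symmetrically for `S`). [cite: GlazmanManolescu2019, §1, Fig. 1] -/
theorem fc_add_of_straight_after_N {j : ℕ} (hN : γ.sOut j = .N) :
    ∀ n, j + n < γ.arcs.length → (∀ m, 1 ≤ m → m < n → arcKind (γ.sIn (j + m)) (γ.sOut (j + m)) = .straight) →
      γ.fc (j + n) = ((γ.fc j).1, (γ.fc j).2 + n) ∧ (n = 0 ∨ γ.sIn (j + n) = .S)
  | 0, _, _ => ⟨by simp, Or.inl rfl⟩
  | n + 1, hlen, hstr => by
      obtain ⟨hfc, hin⟩ := fc_add_of_straight_after_N hN n (by omega) (fun m h1 h2 => hstr m h1 (by omega))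
      have hout : γ.sOut (j + n) = .N := by
        by_cases hn0 : n = 0
        · subst hn0; simpa using hN
        rcases hin with h0 | hS
        · exact absurd h0 hn0
        · have hk := hstr n (by omega) (by omega)
          rw [hS] at hk
          have hne := γ.sIn_ne_sOut (show j + n < γ.arcs.length by omega)
          rw [hS] at hne
          revert hk hne; cases γ.sOut (j + n) <;> decide
      have h1 := γ.fc_succ_eq_of_sOut_N (show j + n + 1 < γ.arcs.length by omega) hout
      have h2 := γ.sIn_succ_of_sOut_N (show j + n + 1 < γ.arcs.length by omega) hout
      refine ⟨?_, Or.inr (by rw [← add_assoc]; exact h2)⟩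
      rw [← add_assoc, h1, hfc]; simp only; push_cast; ring_nf

/-- The mirror statement for a run started through `S`. [cite: GlazmanManolescu2019, §1, Fig. 1] -/
theorem fc_add_of_straight_after_S {j : ℕ} (hS : γ.sOut j = .S) :
    ∀ n, j + n < γ.arcs.length → (∀ m, 1 ≤ m → m < n → arcKind (γ.sIn (j + m)) (γ.sOut (j + m)) = .straight) →
      γ.fc (j + n) = ((γ.fc j).1, (γ.fc j).2 - n) ∧ (n = 0 ∨ γ.sIn (j + n) = .N)
  | 0, _, _ => ⟨by simp, Or.inl rfl⟩
  | n + 1, hlen, hstr => by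
      obtain ⟨hfc, hin⟩ := fc_add_of_straight_after_S hS n (by omega) (fun m h1 h2 => hstr m h1 (by omega))
      have hout : γ.sOut (j + n) = .S := by
        by_cases hn0 : n = 0
        · subst hn0; simpa using hS
        rcases hin with h0 | hN
        · exact absurd h0 hn0
        · have hk := hstr n (by omega) (by omega)
          rw [hN] at hk
          have hne := γ.sIn_ne_sOut (show j + n < γ.arcs.length by omega)
          rw [hN] at hne
          revert hk hne; cases γ.sOut (j + n) <;> decide
      have h1 := γ.fc_succ_eq_of_sOut_S (show j + n + 1 < γ.arcs.length by omega) hout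
      have h2 := γ.sIn_succ_of_sOut_S (show j + n + 1 < γ.arcs.length by omega) hout
      refine ⟨?_, Or.inr (by rw [← add_assoc]; exact h2)⟩
      rw [← add_assoc, h1, hfc]; simp only; push_cast; ring_nf

end YBWalk

namespace ΩG

variable {D : Set Face} {w r : Face} {ω : ΩG D (w.side .W) r}

/-- The first arc in `r`: face and sides (public restatement of the private bookkeeping lemma, for use outside this namespace).
[cite: Glazman2015WeightedSAW, Lemma 3.1 (proof, pp. 6–7: the first crossing of `∂r`)] -/
theorem fc_fh' (ω : ΩG D (w.side .W) r) (hr : RootedFace D (w.side .W) r) (h : ω.IsB2a) :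
    ω.2.fc ω.2.firstHitG = r ∧ ω.2.sIn ω.2.firstHitG = ω.2.firstSideG ∧ ω.2.sOut ω.2.firstHitG = ω.z1 hr h :=
  fc_fh ω hr h

/-- ★★ **ONE PREFIX TURN LEAVES THE ROOT ROW FOR GOOD**: for a class-`B2a` walk from the hole root at a rhombus `r` of the root row
(`r.2 = w.2`), if at most one arc before the first arc in `r` turns then NONE does — after its initial straight run east along the hole row a
single turn sends the walk north or south, and straight arcs keep it in that column, off the row of `r`.
[cite: GlazmanManolescu2019, §1, Fig. 1; Lemma 2.1] [cite: Glazman2015WeightedSAW, Lemma 3.1 (proof, pp. 6–7: the first crossing of `∂r`)] -/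
theorem prefix_straight_of_few_turns (hh : holeFaceW w ∉ D) (hr : RootedFace D (w.side .W) r) (h : ω.IsB2a) (hrow : r.2 = w.2)
    (hfew : ∀ i j, i < j → j < ω.2.firstHitG → arcKind (ω.2.sIn i) (ω.2.sOut i) ≠ .straight →
      arcKind (ω.2.sIn j) (ω.2.sOut j) = .straight) :
    ∀ i < ω.2.firstHitG, arcKind (ω.2.sIn i) (ω.2.sOut i) = .straight := by
  by_contra hne
  push Not at hne
  obtain ⟨i₀, hi₀, hk₀⟩ := hne
  -- the first turning arc before the first hit
  classical
  have hex : ∃ i, i < ω.2.firstHitG ∧ arcKind (ω.2.sIn i) (ω.2.sOut i) ≠ .straight := ⟨i₀, hi₀, hk₀⟩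
  let j := Nat.find hex
  obtain ⟨hj, hkj⟩ := Nat.find_spec hex
  have hmin : ∀ i < j, arcKind (ω.2.sIn i) (ω.2.sOut i) = .straight := by
    intro i hi
    by_contra hk
    exact Nat.find_min hex hi ⟨by omega, hk⟩
  have hfh := ω.fh_lt h
  obtain ⟨hfcr, -, -⟩ := fc_fh ω hr h
  -- the initial run reaches `(w.1 + j, w.2)` entering through `W`; the arc `j` turns north or south
  obtain ⟨hrun, -⟩ := ω.2.initial_run hh (show j < ω.2.arcs.length by omega) hmin
  obtain ⟨hfcj, hWj⟩ := hrun j le_rfl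
  have hlater : ∀ m, 1 ≤ m → m < ω.2.firstHitG - j → arcKind (ω.2.sIn (j + m)) (ω.2.sOut (j + m)) = .straight :=
    fun m h1 h2 => hfew j (j + m) (by omega) (by omega) hkj
  have hsd := ω.2.sIn_ne_sOut (show j < ω.2.arcs.length by omega)
  rw [hWj] at hsd hkj
  cases hs : ω.2.sOut j
  · exact absurd hs hsd.symm
  · rw [hs] at hkj; exact absurd rfl hkj
  · -- south
    obtain ⟨hfc, -⟩ := ω.2.fc_add_of_straight_after_S hs (ω.2.firstHitG - j) (by omega) hlater
    rw [show j + (ω.2.firstHitG - j) = ω.2.firstHitG by omega, hfcr, hfcj] at hfc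
    have := congrArg Prod.snd hfc
    simp only at this; omega
  · -- north
    obtain ⟨hfc, -⟩ := ω.2.fc_add_of_straight_after_N hs (ω.2.firstHitG - j) (by omega) hlater
    rw [show j + (ω.2.firstHitG - j) = ω.2.firstHitG by omega, hfcr, hfcj] at hfc
    have := congrArg Prod.snd hfc
    simp only at this; omega

/-- Two turning indices give a turning count `≥ 2`. [folklore] (lane plumbing) -/
private theorem two_le_countP_of_lt {α : Type*} (l : List α) (P : α → Bool) {i j : ℕ} (hij : i < j) (hj : j < l.length)
    (hi : P l[i] = true) (hjP : P l[j] = true) : 2 ≤ l.countP P := by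
  have hsplit : l.countP P = (l.take j).countP P + (l[j] :: l.drop (j + 1)).countP P := by
    conv_lhs => rw [← List.take_append_drop j l, List.drop_eq_getElem_cons hj]
    rw [List.countP_append]
  have hmem : l[i] ∈ l.take j := by
    have e : (l.take j)[i]'(by rw [List.length_take]; omega) = l[i] := List.getElem_take
    rw [← e]; exact List.getElem_mem _
  have h1 : 0 < (l.take j).countP P := List.countP_pos_iff.2 ⟨_, hmem, hi⟩
  rw [hsplit, List.countP_cons, hjP]; simp; omega

/-- ★ **COUNTING FORM**: if the arcs before the first arc in `r` carry at most ONE turning arc, then no two of them turn.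
[cite: GlazmanManolescu2019, §1, Fig. 1 (lane plumbing)] -/
theorem few_turns_of_countP_le_one (h : ω.IsB2a)
    (hc : (ω.2.arcs.take ω.2.firstHitG).countP (fun p => qTurnOf p ≠ 0) ≤ 1) :
    ∀ i j, i < j → j < ω.2.firstHitG → arcKind (ω.2.sIn i) (ω.2.sOut i) ≠ .straight →
      arcKind (ω.2.sIn j) (ω.2.sOut j) = .straight := by
  intro i j hij hj hki
  have hfh := ω.fh_lt h
  by_contra hkj
  have hi' : i < ω.2.arcs.length := by omega
  have hj' : j < ω.2.arcs.length := by omega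
  have hlen : j < (ω.2.arcs.take ω.2.firstHitG).length := by rw [List.length_take]; omega
  have ei : (ω.2.arcs.take ω.2.firstHitG)[i]'(by omega) = ω.2.arcs[i] := List.getElem_take
  have ej : (ω.2.arcs.take ω.2.firstHitG)[j]'hlen = ω.2.arcs[j] := List.getElem_take
  have hqi : decide (qTurnOf ((ω.2.arcs.take ω.2.firstHitG)[i]'(by omega)) ≠ 0) = true := by
    rw [ei]; simpa using (ω.2.qTurnOf_getElem_ne_zero_iff hi').2 hki
  have hqj : decide (qTurnOf ((ω.2.arcs.take ω.2.firstHitG)[j]'hlen) ≠ 0) = true := by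
    rw [ej]; simpa using (ω.2.qTurnOf_getElem_ne_zero_iff hj').2 hkj
  have := two_le_countP_of_lt _ (fun p => decide (qTurnOf p ≠ 0)) hij hlen hqi hqj
  omega

/-- The turning arcs of a class-`B2a` walk split as prefix + first arc in `r` + excursion. [cite: GlazmanManolescu2019, Lemma 2.1 (the first arc in `r`); lane plumbing] -/
theorem turns_split (h : ω.IsB2a) :
    (ω.2.arcs.take ω.2.firstHitG).countP (fun p => qTurnOf p ≠ 0) +
        (if qTurnOf (ω.2.arcs[ω.2.firstHitG]'(ω.fh_lt h)) ≠ 0 then 1 else 0) +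
        (ω.2.arcs.drop (ω.2.firstHitG + 1)).countP (fun p => qTurnOf p ≠ 0) =
      ω.2.arcs.countP (fun p => qTurnOf p ≠ 0) := by
  conv_rhs => rw [arcs_eq_take_append h]
  rw [List.countP_append, List.countP_cons]
  by_cases hz : qTurnOf (ω.2.arcs[ω.2.firstHitG]'(ω.fh_lt h)) ≠ 0
  · simp [hz]; omega
  · simp [hz]

/-- ★★★ **STRAIGHT PREFIX AT COST `5` ON THE ROOT ROW**: a wound class-`B2a` walk of limit cost `5` from the hole root with injective plaquette
map, at a rhombus of the root row, has a straight prefix — of its five turning arcs (`end_slanted_of_injective_cost_five`) the excursion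
carries at least four (`four_le_excursion_turns_of_wound`), so the prefix carries at most one, hence none (`prefix_straight_of_few_turns`).
[cite: GlazmanManolescu2019, §1, Fig. 1 and eq. (1); Lemma 2.1 (statement, «in the form given in [Gl]»)] [cite: Glazman2015WeightedSAW, Lemma 3.1 (proof, pp. 6–7)] -/
theorem prefix_straight_of_injective_cost_five (hh : holeFaceW w ∉ D) (hr : RootedFace D (w.side .W) r) (h : ω.IsB2a)
    (hA : ω.AJ hr h (toC (midPt (w.side .W))) ≠ 0) (hc : cost (slotOfSide ω.1) ω.2.mids = 5) (hrow : r.2 = w.2)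
    (hinj : ∀ i j, i < ω.2.arcs.length → j < ω.2.arcs.length → ω.2.fc i = ω.2.fc j → i = j) :
    ∀ i < ω.2.firstHitG, arcKind (ω.2.sIn i) (ω.2.sOut i) = .straight := by
  have hz := end_slanted_of_injective_cost_five hh hr h hA hc hinj
  have hd : slotDeg (slotOfSide ω.1) = 1 := by rcases hz with e | e <;> rw [e] <;> rfl
  have hiso := isolated_eq_of_cost_five hc
  rw [hd] at hiso
  obtain ⟨hp1, hp2⟩ := ω.2.pairs_eq_zero_of_injective hinj
  have hT : ω.2.arcs.countP (fun p => qTurnOf p ≠ 0) = 5 := by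
    rw [ω.2.turns_eq_isolated_add_two_pairs, hp1, hp2, hiso]
  have h4 := four_le_excursion_turns_of_wound hr h hA
  have hsplit := turns_split h
  refine prefix_straight_of_few_turns hh hr h hrow (few_turns_of_countP_le_one h ?_)
  split_ifs at hsplit <;> omega

/-- ★★★ **STRAIGHT PREFIX AT COST `7` WITH A VERTICAL END AND A TURNING FIRST ARC**: a wound class-`B2a` walk of limit cost `7` from the
hole root returning to a vertical side of a root-row rhombus, whose first arc in `r` turns and whose plaquette map is injective, has a
straight prefix (six turning arcs: one in `r`, at least four in the excursion). [cite: GlazmanManolescu2019, §1, Fig. 1 and eq. (1); Lemma 2.1]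
[cite: Glazman2015WeightedSAW, Lemma 3.1 (proof, pp. 6–7)] -/
theorem prefix_straight_of_injective_cost_seven_vert (hh : holeFaceW w ∉ D) (hr : RootedFace D (w.side .W) r) (h : ω.IsB2a)
    (hA : ω.AJ hr h (toC (midPt (w.side .W))) ≠ 0) (hv : ω.1 = .E ∨ ω.1 = .W) (hc : cost (slotOfSide ω.1) ω.2.mids = 7)
    (hNS : arcKind (ω.2.sIn ω.2.firstHitG) (ω.2.sOut ω.2.firstHitG) ≠ .straight) (hrow : r.2 = w.2)
    (hinj : ∀ i j, i < ω.2.arcs.length → j < ω.2.arcs.length → ω.2.fc i = ω.2.fc j → i = j) :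
    ∀ i < ω.2.firstHitG, arcKind (ω.2.sIn i) (ω.2.sOut i) = .straight := by
  have hd : slotDeg (slotOfSide ω.1) = 0 := by rcases hv with e | e <;> rw [e] <;> rfl
  have hiso : cfgCount ω.2.mids [.corner] + cfgCount ω.2.mids [.coCorner] = 6 := by
    unfold cost at hc; rw [hd] at hc; omega
  obtain ⟨hp1, hp2⟩ := ω.2.pairs_eq_zero_of_injective hinj
  have hT : ω.2.arcs.countP (fun p => qTurnOf p ≠ 0) = 6 := by
    rw [ω.2.turns_eq_isolated_add_two_pairs, hp1, hp2, hiso]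
  have h4 := four_le_excursion_turns_of_wound hr h hA
  have hfq : qTurnOf (ω.2.arcs[ω.2.firstHitG]'(ω.fh_lt h)) ≠ 0 := (ω.2.qTurnOf_getElem_ne_zero_iff (ω.fh_lt h)).2 hNS
  have hsplit := turns_split h
  rw [if_pos hfq] at hsplit
  exact prefix_straight_of_few_turns hh hr h hrow (few_turns_of_countP_le_one h (by omega))

/-- ★★★ **THE ROW LAW MODULO (R2), member by member.** At a rhombus of the ROOT ROW, every wound group member of limit cost `5` whose class-`B2a`
walk has an injective plaquette map is ROW-COHERENT: the class-`B2a` walk itself when its cost is `5`, and the two-arc extension of an `NS`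
group when ITS cost is `5` (then the parent has cost `5` with a slanted end, or cost `7` with a vertical end).
[cite: GlazmanManolescu2019, §1, Fig. 1 and eq. (1); Lemma 2.1, eq. (CR)] [cite: Glazman2015WeightedSAW, Lemma 3.1 (proof, pp. 6–7)] -/
theorem rowCoherent_of_injective (hh : holeFaceW w ∉ D) (hr : RootedFace D (w.side .W) r) (h : ω.IsB2a)
    (hA : ω.AJ hr h (toC (midPt (w.side .W))) ≠ 0) (hrow : r.2 = w.2)
    (hinj : ∀ i j, i < ω.2.arcs.length → j < ω.2.arcs.length → ω.2.fc i = ω.2.fc j → i = j) :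
    (cost (slotOfSide ω.1) ω.2.mids = 5 → RowCoherent (slotOfSide ω.1) ω.2.mids) ∧
      (∀ hN : IsNS ω hr, cost (slotOfSide (ω.ext₃ hr).1) (ω.ext₃ hr).2.mids = 5 →
        RowCoherent (slotOfSide (ω.ext₃ hr).1) (ω.ext₃ hr).2.mids) := by
  refine ⟨fun hc => ?_, fun hN hc => ?_⟩
  · exact (rowCoherent_of_cost_five hh hr h hA hc hinj (prefix_straight_of_injective_cost_five hh hr h hA hc hrow hinj)).1
  · obtain ⟨-, hf2, hf3⟩ := fc_fh ω hr h
    have hNS : arcKind (ω.2.sIn ω.2.firstHitG) (ω.2.sOut ω.2.firstHitG) ≠ .straight := by rw [hf2, hf3]; exact hN.2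
    have hstr : ∀ i < ω.2.firstHitG, arcKind (ω.2.sIn i) (ω.2.sOut i) = .straight := by
      rcases (cost_ext₃_eq_five_iff hr h hNS).1 hc with ⟨hc5, -⟩ | ⟨hc7, hEW⟩
      · exact prefix_straight_of_injective_cost_five hh hr h hA hc5 hrow hinj
      · exact prefix_straight_of_injective_cost_seven_vert hh hr h hA hEW hc7 hNS hrow hinj
    exact rowCoherent_ext₃_of_cost_five hh hr hN hA hc hinj hstr

end ΩG

end Literature.Probability.RandomPlanarGeometry.SAW.YangBaxter

/-! ## The root-row law of the printed vertex functional, modulo (R2) -/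

namespace Literature.Barriers.CriticalPhenomena.PlaquetteWalk

open Literature.Probability.RandomPlanarGeometry.SAW.YangBaxter
open Real

open private IsNS from Literature.Probability.RandomPlanarGeometry.YangBaxterSAWGeneralDomain

variable (Dl : List Face)

open Classical in
/-- ★★★★ **THE ROOT-ROW LAW MODULO (R2).** Let `a = w.side W` be a `W`-normalised hole root of the finite domain `dom Dl` (hole `(w.1 − 1, w.2)`
absent) and `f₀` a rooted rhombus of the ROOT ROW (`f₀.2 = w.2`). Suppose (R2): every WOUND class-`B2a` walk at `f₀` which has limit cost `5`,
or which has limit cost `7`, returns to a vertical side of `f₀` and turns at its first arc in `f₀`, visits no plaquette twice (injective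
plaquette map) — the exact census of the lane (kits j276221, j280313: `n_{w₁} = n_{w₂} = 0` in all of them); and suppose some wound class-`B2a`
walk of limit cost `5` exists at `f₀`. Then the printed Yang–Baxter vertex functional `VF_D(a, f₀; ·)` is NOT identically zero in the angle:
finitely many zeros in `(0, π)`, at most `4·maxExp − 4` — the lane's «Λ₅ ≠ 0 on the root row», reduced to the structural statement (R2).
[cite: GlazmanManolescu2019, Lemma 2.1 and eq. (1)] [cite: Glazman2015WeightedSAW, Lemma 3.1 (proof, pp. 6–7)] -/
theorem vertexFunctional_printed_zero_set_finite_of_noDoubleVisit {w f₀ : Face} (hh : holeFaceW w ∉ dom Dl)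
    (hr : RootedFace (dom Dl) (w.side .W) f₀) (hrow : f₀.2 = w.2)
    (hR2 : ∀ (ω : ΩG (dom Dl) (w.side .W) f₀) (h : ω.IsB2a), ω.AJ hr h (toC (midPt (w.side .W))) ≠ 0 →
      (cost (slotOfSide ω.1) ω.2.mids = 5 ∨
        (cost (slotOfSide ω.1) ω.2.mids = 7 ∧ (ω.1 = .E ∨ ω.1 = .W) ∧
          arcKind (ω.2.sIn ω.2.firstHitG) (ω.2.sOut ω.2.firstHitG) ≠ .straight)) →
      ∀ i j, i < ω.2.arcs.length → j < ω.2.arcs.length → ω.2.fc i = ω.2.fc j → i = j)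
    (hex : ∃ (ω : ΩG (dom Dl) (w.side .W) f₀) (h : ω.IsB2a), ω.AJ hr h (toC (midPt (w.side .W))) ≠ 0 ∧
      cost (slotOfSide ω.1) ω.2.mids = 5) :
    {θ ∈ Set.Ioo 0 π | vertexFunctional (printedWeights θ) tFiveEighths (ybCoeff θ) Dl (w.side .W) f₀ = 0}.Finite ∧
      {θ ∈ Set.Ioo 0 π | vertexFunctional (printedWeights θ) tFiveEighths (ybCoeff θ) Dl (w.side .W) f₀ = 0}.ncard ≤
        4 * maxExp Dl (w.side .W) f₀ + 1 - 5 := by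
  -- membership in the wound-member set: class `B2a` and not unwound
  have hmem : ∀ ω : ΩG (dom Dl) (w.side .W) f₀,
      ω ∈ (ΩG.setB2a (dom Dl) (w.side .W) f₀).filter (fun ω => ¬ω.Unwound hr) ↔
        ∃ h : ω.IsB2a, ω.AJ hr h (toC (midPt (w.side .W))) ≠ 0 := by
    intro ω
    rw [Finset.mem_filter, ΩG.unwound_iff_AJ_root_eq_zero]
    unfold ΩG.setB2a
    rw [Finset.mem_filter]
    simp only [Finset.mem_univ, true_and, not_forall]
    constructor
    · rintro ⟨h, ⟨h', hA⟩⟩; exact ⟨h', hA⟩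
    · rintro ⟨h, hA⟩; exact ⟨h, ⟨h, hA⟩⟩
  refine vertexFunctional_printed_zero_set_finite_of_rowCoherent Dl hh hr (fun ω hω => ?_) ?_
  · obtain ⟨h, hA⟩ := (hmem ω).1 hω
    have key : ∀ hN : IsNS ω hr, cost (slotOfSide (ω.ext₃ hr).1) (ω.ext₃ hr).2.mids = 5 →
        RowCoherent (slotOfSide (ω.ext₃ hr).1) (ω.ext₃ hr).2.mids := by
      intro hN hc
      obtain ⟨-, hf2, hf3⟩ := ΩG.fc_fh' ω hr h
      have hNS : arcKind (ω.2.sIn ω.2.firstHitG) (ω.2.sOut ω.2.firstHitG) ≠ .straight := by rw [hf2, hf3]; exact hN.2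
      have hinj := hR2 ω h hA (by
        rcases (ΩG.cost_ext₃_eq_five_iff hr h hNS).1 hc with ⟨hc5, -⟩ | ⟨hc7, hEW⟩
        · exact Or.inl hc5
        · exact Or.inr ⟨hc7, hEW, hNS⟩)
      exact (ΩG.rowCoherent_of_injective hh hr h hA hrow hinj).2 hN hc
    refine ⟨fun hc => ?_, key⟩
    have hinj := hR2 ω h hA (Or.inl hc)
    exact (ΩG.rowCoherent_of_injective hh hr h hA hrow hinj).1 hc
  · obtain ⟨ω, h, hA, hc⟩ := hex
    have hinj := hR2 ω h hA (Or.inl hc)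
    have hz := ΩG.end_slanted_of_injective_cost_five hh hr h hA hc hinj
    have hd : slotDeg (slotOfSide ω.1) = 1 := by rcases hz with e | e <;> rw [e] <;> rfl
    exact ⟨ω, (hmem ω).2 ⟨h, hA⟩, Or.inl ⟨hc, hd⟩⟩

end Literature.Barriers.CriticalPhenomena.PlaquetteWalk
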